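import Summits.QuantumFields.YangMills.Theorems.BalabanUVNodesN16HolderMultiScale
import HarnessLib

/-!
# Route «BalabanUVNodes», cluster K4 «SpineRates» — node N16 = NE3: THE WINDOW-FREE HÖLDER ROAD (repair R-β″ of the located item
# «the Hölder-exponent pin of N16's N05-socket»), CONSUMER HALF, module 2 of 2: NE7's three closeness coordinates (Gᶜ)∕(C)∕(Q) and its
# consumer-side END from the covariant root WITH THE MULTI-SCALE (3.40) HÖLDER MEMBER, at rate `(θ^k)^{(12+14β)∕(1+β)}` — below the plaquette
# margin `θ^{12k}` for EVERY Hölder exponent `β > 0`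

Cell `pub-ymgap`, seat `pub-ymgap-dag-n16-c` (R134 fan-out seat, strategy s1; HUMAN RULING D-0062; chair R424 venue), generation 4, file 21 (sequel of file 20
`BalabanUVNodesN16HolderMultiScale` = module 1: the Landau–Kolmogorov step with a Hölder modulus, the exponent bookkeeping, «multi-scale β-root ⇒ β-root»).
`--supports stmt-QuantumFields-19912 --as helper` (K3‴ `SpineGivenEndpointR13`, route rev 16; lineage K3′ 19908).  `bears_on: R4∕N16 · out-edges N16 → N19∕N21 ·
GAPS caveat (c2)`.  Located item: `HOME/pub-ymgap-dag-n16-c/LOCATED-N16-HOLDER-PIN.md`, census row R-β″ (ADDENDUM 3 (iii)).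

WHAT THIS FILE PROVES (kernel, theorems only, 0 `def`, 0 sorry) — `N16HolderWindow` §1∕§3 with the nearest-neighbour member `hlip2h` REPLACED by the multi-scale
member `hlipMS` «along every lattice line, the covariant difference `j` steps ahead, transported back by the line holonomy, differs from the one at the base by at
most `Λ₂′·ξ^{2+β}·j^β` for `1 ≤ j ≤ L^k`» ([Balaban1985BackgroundPropagators] (3.40) read along lines; `Λ₂′ ≥ 0`, `0 ≤ β ≤ 1`):
§1 `norm_covDiff_le_rate_holderMS` — (Gᶜ) `≤ (32l₁²γ + 2Λ₂′)·(θ^k)^{(12+14β)∕(1+β)}` from (E) + (Lip₁ᶜ) + (Lip₂ᴹˢ)_β + FIT (module 1 §2 with the sup bound (P)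
   `M = 8l₁²γθ^{8k}` of `NE7EtaRatesD4Cov.norm_dir_le_rate_cov`, `H = Λ₂′ξ^{2+β}` and interpolation length `m = ⌈(θ^k)^{−(4+6β)∕(1+β)}⌉ ∧ L^k`);
   `norm_curl_le_rate_holderMS` — (C) twice that; `norm_hol_sub_le_rate_holderMS` — (Q) `≤ (2(32l₁²γ + 2Λ₂′) + 1536l₁⁴γ²e^{8l₁²γ})·(θ^k)^{(12+14β)∕(1+β)}`.
§2 `closeness_of_covRoot_holderMS` — NE7's consumer-side END (`NE7EtaCurlFromCovGradient.closeness_of_covRoot₂`'s shape) from the covariant root with the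
   multi-scale third conjunct (hypothesis inline, eight conjuncts): (P) `θ^{8k}`, (Gᶜ)∕(C)∕(Q) at `(θ^k)^{(12+14β)∕(1+β)}`; by module 1 §3 the three rates
   equal `ξ²·(θ^{2β∕(1+β)})^k` — GEOMETRIC below the margin for every `β > 0` (the nearest-neighbour twin `N16HolderWindow.closeness_of_covRoot_holder` needs
   `β > 2∕3`), and never worse than the nearest-neighbour rates on `β ∈ [0,1]`.
HONEST FRAMING: bookkeeping + one interpolation over landed modules; the multi-scale β-root is a HYPOTHESIS (nobody's theorem; its producer half — the
multi-scale pass-through leaf → (OUT_print) → `LandauRepB8` → END — is not typed); nothing of NE3 ∕ NE7 discharged; N16 ∕ NE3 NOT discharged; count-neutral;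
one finite four-torus at fixed ε — NOT ℝ⁴, NOT infinite volume, NOT OS, NOT a mass gap, NOT Clay.
-/

set_option autoImplicit false

open scoped BigOperators Matrix Matrix.Norms.L2Operator
open Finset

namespace Summit.QuantumFields.YangMills.BalabanUVNodes.N16HolderMultiScaleRates

open Literature.MathematicalPhysics.QuantumFieldTheory.Balaban1983to89
open B7Prop1Explicit B7Prop2Explicit
open T4AveragingDeficitWall hiding Site Plane Plaq Bond
open T4AveragingDeficitWallBoundary (periodBox IsPeriodicCfg)
open Summit.QuantumFields.BalabanUV.T4Continuum
open AveragingDeficitPeriodicCounting (IsPeriodicDir)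
open AveragingDeficitDualResidual (dualC1 dualC2)
open AveragingDeficitDerivWallProof (wallConst)
open MinimalActionSandwich (IsMinimiser)
open MinimalActionRate (Regular)
open NE3EnergyShapes (residualScale IsUnitarySite IsPeriodicSite)
open NE3EnergyWeightedShapes (energyNormW)
open NE3HessContinuity (bondL1At bondL1At_nonneg)
open NE3EnergySmallFieldCurl (norm_hol_vary_sub_hol_le_curl)
open NE7EtaRatesD4 (scale_eq scale_le_half energy_budget_of_residualScale)
open NE7EtaRatesD4Cov (norm_dir_le_rate_cov)
open NE7EtaRatesD4CovReg (unitary_periodic_rescale_bavg_of_regular)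
open NE7EtaCurlFromCovGradient (norm_curl_le_two_mul_of_covDiff norm_curlAt_le_two_mul_of_covDiff)
open N16HolderWindow (rpow_pow_six)
open N16HolderMultiScale (norm_covDiff_le_of_sup_of_covHolderMod rateMS_exponent_eq_eight_add rateMS_exponent_eq_twelve_add
  rateMS_exponent_le_fourteen)

noncomputable section

/-! ## §1 The three coordinates from (E) + (Lip₁ᶜ) + (Lip₂ᴹˢ)_β at the window-free rate `(θ^k)^{(12+14β)∕(1+β)}` -/

section Rates

variable {n : Type*} [Fintype n] [DecidableEq n]

/-- **THE COVARIANT GRADIENT COORDINATE FROM THE MULTI-SCALE HÖLDER MEMBER**: `d = 4`, `θ⁶ = L⁻¹`, one `N L^k`-periodic pair `(W, Z)`, `W` unitary; (E)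
`L^k·energyNormW ≤ γ³`; (Lip₁ᶜ) `Λ₁ ≤ l₁³`; (Lip₂ᴹˢ)_β «along every lattice line, the covariant difference `j` steps ahead, transported back by the line
holonomy, differs from the one at the base by at most `Λ₂′·ξ^{2+β}·j^β` for `1 ≤ j ≤ L^k`» (`Λ₂′ ≥ 0`, `0 ≤ β ≤ 1`; print's (3.40) quotient over all pairs up
to unit distance, read along lines); FIT `γ(θ^k)² ≤ l₁N`.  THEN `‖Ad (W (x + e κ) μ) (Z (x + e μ) κ) − Z x κ‖ ≤ (32l₁²γ + 2Λ₂′)·(θ^k)^{(12+14β)∕(1+β)}`: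
module 1 §2 with the sup bound (P) `M = 8l₁²γθ^{8k}` of `NE7EtaRatesD4Cov.norm_dir_le_rate_cov`, `H = Λ₂′ξ^{2+β}`, and `m = ⌈(θ^k)^{−(4+6β)∕(1+β)}⌉ ∧ L^k`.
[cite: Balaban1985BackgroundPropagators, (3.40) p.397; Balaban1985RegularSpaces, (1.36) p.82] [folklore] -/
theorem norm_covDiff_le_rate_holderMS {L N k : ℕ} (hL : 2 ≤ L) (hN : 1 ≤ N) (hk : 1 ≤ k) {θ : ℝ} (hθ : 0 < θ)
    (hθ6 : θ ^ 6 = ((L : ℝ))⁻¹) {W : Site 4 → Fin 4 → (Matrix n n ℂ)ˣ} {Z : Site 4 → Fin 4 → Matrix n n ℂ}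
    (hWu : IsUnitaryCfg W) (hWP : IsPeriodicCfg W ((N * L ^ k : ℕ) : ℤ)) (hZP : IsPeriodicDir Z ((N * L ^ k : ℕ) : ℤ))
    {γ Λ₁ l₁ Λ₂' β : ℝ} (hγ : 0 < γ) (hl₁ : 0 < l₁) (hΛl : Λ₁ ≤ l₁ ^ 3) (hΛ₂' : 0 ≤ Λ₂') (hβ0 : 0 ≤ β) (hβ1 : β ≤ 1)
    (hE : (L : ℝ) ^ k * energyNormW L k W Z (periodBox (d := 4) (N * L ^ k)) ≤ γ ^ 3)
    (hlipc : ∀ (κ : Fin 4) (x : Site 4) (μ : Fin 4), ‖Ad (W (x + e κ) μ) (Z (x + e μ) κ) - Z x κ‖ ≤ Λ₁ * (((L : ℝ)⁻¹) ^ k) ^ 2)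
    (hlipMS : ∀ (κ μ : Fin 4) (y : Site 4) (j : ℕ), 1 ≤ j → j ≤ L ^ k →
      ‖Ad (((List.range j).map fun i : ℕ => W (y + e κ + i • e μ) μ).prod)
            (Ad (W (y + e κ + j • e μ) μ) (Z (y + (j + 1) • e μ) κ) - Z (y + j • e μ) κ)
        - (Ad (W (y + e κ) μ) (Z (y + e μ) κ) - Z y κ)‖ ≤ Λ₂' * (((L : ℝ)⁻¹) ^ k) ^ ((2 : ℝ) + β) * (j : ℝ) ^ β)
    (hfit : γ * (θ ^ k) ^ 2 ≤ l₁ * N) (x : Site 4) (μ κ : Fin 4) :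
    ‖Ad (W (x + e κ) μ) (Z (x + e μ) κ) - Z x κ‖
      ≤ (32 * l₁ ^ 2 * γ + 2 * Λ₂') * (θ ^ k) ^ (((12 : ℝ) + 14 * β) / (1 + β)) := by
  have hL1 : 1 ≤ L := by omega
  obtain ⟨hξ, hLs⟩ := scale_eq hL1 hθ6 k
  obtain ⟨-, hs1⟩ := scale_le_half hL hθ hθ6 hk
  set s : ℝ := θ ^ k with hsdef
  have hs : 0 < s := pow_pos hθ k
  -- letters: the sup bound (P), the Hölder constant H, the exponents a and ρ
  set M : ℝ := 8 * l₁ ^ 2 * γ * θ ^ (8 * k) with hMdef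
  have hsup : ∀ y, ‖Z y κ‖ ≤ M := fun y =>
    norm_dir_le_rate_cov hL hN hk hθ hθ6 hWu hWP hZP hγ hl₁ hΛl hE hlipc hfit y κ
  have e8 : θ ^ (8 * k) = s ^ 8 := by rw [hsdef, ← pow_mul, mul_comm k 8]
  have hMs : M = 8 * l₁ ^ 2 * γ * s ^ 8 := by rw [hMdef, e8]
  have hM0 : 0 ≤ M := by rw [hMs]; positivity
  set H : ℝ := Λ₂' * (((L : ℝ)⁻¹) ^ k) ^ ((2 : ℝ) + β) with hHdef
  have hHs : H = Λ₂' * s ^ ((12 : ℝ) + 6 * β) := by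
    rw [hHdef, hξ, rpow_pow_six hs.le]; ring_nf
  have hH0 : 0 ≤ H := by rw [hHs]; exact mul_nonneg hΛ₂' (Real.rpow_nonneg hs.le _)
  set a : ℝ := (4 + 6 * β) / (1 + β) with hadef
  set ρ : ℝ := ((12 : ℝ) + 14 * β) / (1 + β) with hρdef
  have ha0 : 0 ≤ a := div_nonneg (by linarith) (by linarith)
  have hρ8 : ρ = 8 + a := rateMS_exponent_eq_eight_add hβ0
  have hρ12 : ρ = 12 + 6 * β - a * β := rateMS_exponent_eq_twelve_add hβ0
  have hρ14 : ρ ≤ 14 := rateMS_exponent_le_fourteen hβ0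
  have hsρ : 0 ≤ s ^ ρ := Real.rpow_nonneg hs.le ρ
  -- the interpolation length
  set t : ℝ := s ^ (-a) with htdef
  have ht0 : 0 < t := Real.rpow_pos_of_pos hs _
  have ht1 : 1 ≤ t := Real.one_le_rpow_of_pos_of_le_one_of_nonpos hs hs1 (by linarith)
  have htinv : t⁻¹ = s ^ a := by rw [htdef, Real.rpow_neg hs.le, inv_inv]
  set m : ℕ := min ⌈t⌉₊ (L ^ k) with hmdef
  have hLk1 : 1 ≤ L ^ k := Nat.one_le_pow k L (by omega)
  have hceil1 : 1 ≤ ⌈t⌉₊ := Nat.one_le_iff_ne_zero.mpr (Nat.pos_iff_ne_zero.mp (Nat.ceil_pos.mpr ht0))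
  have hm1 : 1 ≤ m := le_min hceil1 hLk1
  have hmL : m ≤ L ^ k := min_le_right _ _
  have hmpos : (0 : ℝ) < m := by exact_mod_cast hm1
  have hm2t : (m : ℝ) ≤ 2 * t := by
    have h1 : (m : ℝ) ≤ (⌈t⌉₊ : ℝ) := by exact_mod_cast min_le_left _ _
    have h2 : (⌈t⌉₊ : ℝ) < t + 1 := Nat.ceil_lt_add_one ht0.le
    linarith
  -- §2 with modulus H·j^β for 1 ≤ j < m ≤ L^k
  have hω : ∀ j : ℕ, 1 ≤ j → j < m →
      ‖Ad (((List.range j).map fun i : ℕ => W (x + e κ + i • e μ) μ).prod)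
            (Ad (W (x + e κ + j • e μ) μ) (Z (x + (j + 1) • e μ) κ) - Z (x + j • e μ) κ)
        - (Ad (W (x + e κ) μ) (Z (x + e μ) κ) - Z x κ)‖ ≤ H * (j : ℝ) ^ β :=
    fun j hj1 hj => hlipMS κ μ x j hj1 (by omega)
  have hmain := norm_covDiff_le_of_sup_of_covHolderMod hWu κ μ hβ0 hH0 hsup x hm1 hω
  -- first term: 2M∕m ≤ 32 l₁²γ s^ρ
  have hterm1 : 2 * M / (m : ℝ) ≤ 32 * l₁ ^ 2 * γ * s ^ ρ := by
    have h16 : 2 * M / t = 16 * l₁ ^ 2 * γ * s ^ ρ := by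
      rw [div_eq_mul_inv, htinv, hMs, hρ8, Real.rpow_add hs, show (8 : ℝ) = ((8 : ℕ) : ℝ) by norm_num, Real.rpow_natCast]
      ring
    have h14 : 2 * M / ((L : ℝ) ^ k) ≤ 16 * l₁ ^ 2 * γ * s ^ ρ := by
      have e1 : 2 * M / ((L : ℝ) ^ k) = 16 * l₁ ^ 2 * γ * s ^ 14 := by
        rw [div_eq_mul_inv, ← inv_pow, hξ, hMs]; ring
      have hs14 : s ^ 14 ≤ s ^ ρ := by
        rw [← Real.rpow_natCast s 14]
        exact Real.rpow_le_rpow_of_exponent_ge hs hs1 (by push_cast; linarith)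
      rw [e1]
      exact mul_le_mul_of_nonneg_left hs14 (by positivity)
    have hpos16 : 0 ≤ 16 * l₁ ^ 2 * γ * s ^ ρ := by positivity
    rcases le_total ⌈t⌉₊ (L ^ k) with hc | hc
    · have hm_eq : m = ⌈t⌉₊ := min_eq_left hc
      have hmt : t ≤ (m : ℝ) := by rw [hm_eq]; exact Nat.le_ceil t
      calc 2 * M / (m : ℝ) ≤ 2 * M / t := div_le_div_of_nonneg_left (by positivity) ht0 hmt
        _ = 16 * l₁ ^ 2 * γ * s ^ ρ := h16
        _ ≤ 32 * l₁ ^ 2 * γ * s ^ ρ := by linarith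
    · have hm_eq : m = L ^ k := min_eq_right hc
      have hmc : (m : ℝ) = (L : ℝ) ^ k := by rw [hm_eq]; push_cast; ring
      calc 2 * M / (m : ℝ) = 2 * M / ((L : ℝ) ^ k) := by rw [hmc]
        _ ≤ 16 * l₁ ^ 2 * γ * s ^ ρ := h14
        _ ≤ 32 * l₁ ^ 2 * γ * s ^ ρ := by linarith
  -- second term: H·m^β ≤ 2Λ₂′ s^ρ
  have hterm2 : H * (m : ℝ) ^ β ≤ 2 * Λ₂' * s ^ ρ := by
    have hmb : (m : ℝ) ^ β ≤ (2 * t) ^ β := Real.rpow_le_rpow (Nat.cast_nonneg m) hm2t hβ0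
    have h2t : (2 * t) ^ β = 2 ^ β * t ^ β := Real.mul_rpow (by norm_num) ht0.le
    have h2β : (2 : ℝ) ^ β ≤ 2 := by
      calc (2 : ℝ) ^ β ≤ 2 ^ (1 : ℝ) := Real.rpow_le_rpow_of_exponent_le (by norm_num) hβ1
        _ = 2 := Real.rpow_one 2
    have htβ : t ^ β = s ^ (-a * β) := by rw [htdef, ← Real.rpow_mul hs.le]
    have htβ0 : 0 ≤ t ^ β := Real.rpow_nonneg ht0.le β
    have hHt : H * t ^ β = Λ₂' * s ^ ρ := by
      rw [hHs, htβ, mul_assoc, ← Real.rpow_add hs, hρ12]; ring_nf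
    calc H * (m : ℝ) ^ β ≤ H * (2 * t) ^ β := mul_le_mul_of_nonneg_left hmb hH0
      _ = 2 ^ β * (H * t ^ β) := by rw [h2t]; ring
      _ ≤ 2 * (H * t ^ β) := mul_le_mul_of_nonneg_right h2β (mul_nonneg hH0 htβ0)
      _ = 2 * Λ₂' * s ^ ρ := by rw [hHt]; ring
  calc ‖Ad (W (x + e κ) μ) (Z (x + e μ) κ) - Z x κ‖ ≤ 2 * M / (m : ℝ) + H * (m : ℝ) ^ β := hmain
    _ ≤ 32 * l₁ ^ 2 * γ * s ^ ρ + 2 * Λ₂' * s ^ ρ := add_le_add hterm1 hterm2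
    _ = (32 * l₁ ^ 2 * γ + 2 * Λ₂') * s ^ ρ := by ring

/-- **THE CURL COORDINATE FROM THE MULTI-SCALE HÖLDER MEMBER** (same data): `‖d_W Z (x, π)‖ ≤ 2(32l₁²γ + 2Λ₂′)·(θ^k)^{(12+14β)∕(1+β)}` — twice the
gradient coordinate through «dressed curl = difference of two transported covariant gradients» (`NE7EtaCurlFromCovGradient.norm_curl_le_two_mul_of_covDiff`).
[folklore] -/
theorem norm_curl_le_rate_holderMS {L N k : ℕ} (hL : 2 ≤ L) (hN : 1 ≤ N) (hk : 1 ≤ k) {θ : ℝ} (hθ : 0 < θ)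
    (hθ6 : θ ^ 6 = ((L : ℝ))⁻¹) {W : Site 4 → Fin 4 → (Matrix n n ℂ)ˣ} {Z : Site 4 → Fin 4 → Matrix n n ℂ}
    (hWu : IsUnitaryCfg W) (hWP : IsPeriodicCfg W ((N * L ^ k : ℕ) : ℤ)) (hZP : IsPeriodicDir Z ((N * L ^ k : ℕ) : ℤ))
    {γ Λ₁ l₁ Λ₂' β : ℝ} (hγ : 0 < γ) (hl₁ : 0 < l₁) (hΛl : Λ₁ ≤ l₁ ^ 3) (hΛ₂' : 0 ≤ Λ₂') (hβ0 : 0 ≤ β) (hβ1 : β ≤ 1)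
    (hE : (L : ℝ) ^ k * energyNormW L k W Z (periodBox (d := 4) (N * L ^ k)) ≤ γ ^ 3)
    (hlipc : ∀ (κ : Fin 4) (x : Site 4) (μ : Fin 4), ‖Ad (W (x + e κ) μ) (Z (x + e μ) κ) - Z x κ‖ ≤ Λ₁ * (((L : ℝ)⁻¹) ^ k) ^ 2)
    (hlipMS : ∀ (κ μ : Fin 4) (y : Site 4) (j : ℕ), 1 ≤ j → j ≤ L ^ k →
      ‖Ad (((List.range j).map fun i : ℕ => W (y + e κ + i • e μ) μ).prod)
            (Ad (W (y + e κ + j • e μ) μ) (Z (y + (j + 1) • e μ) κ) - Z (y + j • e μ) κ)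
        - (Ad (W (y + e κ) μ) (Z (y + e μ) κ) - Z y κ)‖ ≤ Λ₂' * (((L : ℝ)⁻¹) ^ k) ^ ((2 : ℝ) + β) * (j : ℝ) ^ β)
    (hfit : γ * (θ ^ k) ^ 2 ≤ l₁ * N) (π : T4AveragingDeficitWall.Plane 4) (x : Site 4) :
    ‖curl W Z (x, π)‖ ≤ 2 * ((32 * l₁ ^ 2 * γ + 2 * Λ₂') * (θ ^ k) ^ (((12 : ℝ) + 14 * β) / (1 + β))) := by
  have hG : ∀ (κ : Fin 4) (x : Site 4) (μ : Fin 4), ‖Ad (W (x + e κ) μ) (Z (x + e μ) κ) - Z x κ‖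
      ≤ (32 * l₁ ^ 2 * γ + 2 * Λ₂') * (θ ^ k) ^ (((12 : ℝ) + 14 * β) / (1 + β)) :=
    fun κ x μ => norm_covDiff_le_rate_holderMS hL hN hk hθ hθ6 hWu hWP hZP hγ hl₁ hΛl hΛ₂' hβ0 hβ1 hE hlipc hlipMS hfit x μ κ
  exact norm_curl_le_two_mul_of_covDiff hWu hG π x

/-- **THE PLAQUETTE COORDINATE FROM THE MULTI-SCALE HÖLDER MEMBER** (`W` unitary, `Z` skew, same data): for every plaquette
`‖(W e^Z)(∂p) − W(∂p)‖ ≤ (2(32l₁²γ + 2Λ₂′) + 1536l₁⁴γ²e^{8l₁²γ})·(θ^k)^{(12+14β)∕(1+β)}` — the NE3 crew's `norm_hol_vary_sub_hol_le_curl` with the curl bound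
and the sup bound (P) in the exponential; the second-order term `∝ (θ^k)^{16}` is dominated because `(12+14β)∕(1+β) ≤ 14 ≤ 16` and `θ^k ≤ 1`
(`N16HolderWindow.norm_hol_sub_le_rate_holder` with the multi-scale rate). [folklore] -/
theorem norm_hol_sub_le_rate_holderMS [Nonempty n] {L N k : ℕ} (hL : 2 ≤ L) (hN : 1 ≤ N) (hk : 1 ≤ k) {θ : ℝ} (hθ : 0 < θ)
    (hθ6 : θ ^ 6 = ((L : ℝ))⁻¹) {W : Site 4 → Fin 4 → (Matrix n n ℂ)ˣ} {Z : Site 4 → Fin 4 → Matrix n n ℂ}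
    (hWu : IsUnitaryCfg W) (hZs : IsSkewDir Z) (hWP : IsPeriodicCfg W ((N * L ^ k : ℕ) : ℤ))
    (hZP : IsPeriodicDir Z ((N * L ^ k : ℕ) : ℤ)) {γ Λ₁ l₁ Λ₂' β : ℝ} (hγ : 0 < γ) (hl₁ : 0 < l₁) (hΛl : Λ₁ ≤ l₁ ^ 3)
    (hΛ₂' : 0 ≤ Λ₂') (hβ0 : 0 ≤ β) (hβ1 : β ≤ 1)
    (hE : (L : ℝ) ^ k * energyNormW L k W Z (periodBox (d := 4) (N * L ^ k)) ≤ γ ^ 3)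
    (hlipc : ∀ (κ : Fin 4) (x : Site 4) (μ : Fin 4), ‖Ad (W (x + e κ) μ) (Z (x + e μ) κ) - Z x κ‖ ≤ Λ₁ * (((L : ℝ)⁻¹) ^ k) ^ 2)
    (hlipMS : ∀ (κ μ : Fin 4) (y : Site 4) (j : ℕ), 1 ≤ j → j ≤ L ^ k →
      ‖Ad (((List.range j).map fun i : ℕ => W (y + e κ + i • e μ) μ).prod)
            (Ad (W (y + e κ + j • e μ) μ) (Z (y + (j + 1) • e μ) κ) - Z (y + j • e μ) κ)
        - (Ad (W (y + e κ) μ) (Z (y + e μ) κ) - Z y κ)‖ ≤ Λ₂' * (((L : ℝ)⁻¹) ^ k) ^ ((2 : ℝ) + β) * (j : ℝ) ^ β)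
    (hfit : γ * (θ ^ k) ^ 2 ≤ l₁ * N) (z : Site 4) (μ ν : Fin 4) :
    ‖((hol (vary W Z 1) z (plaqWord μ ν) : (Matrix n n ℂ)ˣ) : Matrix n n ℂ)
        - ((hol W z (plaqWord μ ν) : (Matrix n n ℂ)ˣ) : Matrix n n ℂ)‖
      ≤ (2 * (32 * l₁ ^ 2 * γ + 2 * Λ₂') + 1536 * l₁ ^ 4 * γ ^ 2 * Real.exp (8 * l₁ ^ 2 * γ))
          * (θ ^ k) ^ (((12 : ℝ) + 14 * β) / (1 + β)) := by
  obtain ⟨-, hs1⟩ := scale_le_half hL hθ hθ6 hk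
  set s : ℝ := θ ^ k with hsdef
  have hs : 0 < s := pow_pos hθ k
  set ρ : ℝ := ((12 : ℝ) + 14 * β) / (1 + β) with hρdef
  have hρ14 : ρ ≤ 14 := rateMS_exponent_le_fourteen hβ0
  set α : ℝ := 8 * l₁ ^ 2 * γ * θ ^ (8 * k) with hαdef
  have hsup : ∀ x κ, ‖Z x κ‖ ≤ α := fun x κ =>
    norm_dir_le_rate_cov hL hN hk hθ hθ6 hWu hWP hZP hγ hl₁ hΛl hE hlipc hfit x κ
  have hG : ∀ (κ : Fin 4) (x : Site 4) (μ : Fin 4),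
      ‖Ad (W (x + e κ) μ) (Z (x + e μ) κ) - Z x κ‖ ≤ (32 * l₁ ^ 2 * γ + 2 * Λ₂') * s ^ ρ :=
    fun κ x μ => norm_covDiff_le_rate_holderMS hL hN hk hθ hθ6 hWu hWP hZP hγ hl₁ hΛl hΛ₂' hβ0 hβ1 hE hlipc hlipMS hfit x μ κ
  have hcurl : ‖curlAt W Z z μ ν‖ ≤ 2 * ((32 * l₁ ^ 2 * γ + 2 * Λ₂') * s ^ ρ) :=
    norm_curlAt_le_two_mul_of_covDiff hWu hG z μ ν
  have h0 := norm_hol_vary_sub_hol_le_curl hWu hZs hsup (t := (1 : ℝ)) zero_le_one z μ ν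
  rw [one_mul, one_mul] at h0
  have e8 : θ ^ (8 * k) = s ^ 8 := by rw [hsdef, ← pow_mul, mul_comm k 8]
  have hα0 : 0 ≤ α := by positivity
  have hαs : α = 8 * l₁ ^ 2 * γ * s ^ 8 := by rw [hαdef, e8]
  have hs8 : s ^ 8 ≤ 1 := pow_le_one₀ hs.le hs1
  have hαle : α ≤ 8 * l₁ ^ 2 * γ := by
    rw [hαs]; nlinarith [mul_le_mul_of_nonneg_left hs8 (by positivity : (0 : ℝ) ≤ 8 * l₁ ^ 2 * γ)]
  have hexp1 : Real.exp α - 1 ≤ α * Real.exp α := by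
    have h1 : Real.exp α * Real.exp (-α) = 1 := by rw [← Real.exp_add, add_neg_cancel, Real.exp_zero]
    nlinarith [mul_le_mul_of_nonneg_left (Real.add_one_le_exp (-α)) (Real.exp_pos α).le, Real.exp_pos α]
  have hexp : Real.exp α - 1 ≤ α * Real.exp (8 * l₁ ^ 2 * γ) :=
    hexp1.trans (mul_le_mul_of_nonneg_left (Real.exp_le_exp.mpr hαle) hα0)
  have hL1 : bondL1At Z z μ ν ≤ 4 * α := by
    unfold bondL1At; linarith [hsup z μ, hsup (z + e μ) ν, hsup (z + e ν) μ, hsup z ν]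
  have h2 : 6 * (Real.exp α - 1) * bondL1At Z z μ ν ≤ 6 * (α * Real.exp (8 * l₁ ^ 2 * γ)) * (4 * α) :=
    mul_le_mul (mul_le_mul_of_nonneg_left hexp (by norm_num)) hL1 (bondL1At_nonneg Z z μ ν) (by positivity)
  -- the second-order term `∝ s^{16}` is below the rate `s^ρ` (`ρ ≤ 14 ≤ 16`, `s ≤ 1`)
  have hs16 : s ^ 16 ≤ s ^ ρ := by
    rw [← Real.rpow_natCast s 16]
    exact Real.rpow_le_rpow_of_exponent_ge hs hs1 (by push_cast; linarith)
  have h3 : 6 * (α * Real.exp (8 * l₁ ^ 2 * γ)) * (4 * α)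
      ≤ 1536 * l₁ ^ 4 * γ ^ 2 * Real.exp (8 * l₁ ^ 2 * γ) * s ^ ρ := by
    rw [hαs]
    have e1 : 6 * (8 * l₁ ^ 2 * γ * s ^ 8 * Real.exp (8 * l₁ ^ 2 * γ)) * (4 * (8 * l₁ ^ 2 * γ * s ^ 8))
        = 1536 * l₁ ^ 4 * γ ^ 2 * Real.exp (8 * l₁ ^ 2 * γ) * s ^ 16 := by ring
    rw [e1]
    exact mul_le_mul_of_nonneg_left hs16 (by positivity)
  calc ‖((hol (vary W Z 1) z (plaqWord μ ν) : (Matrix n n ℂ)ˣ) : Matrix n n ℂ)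
          - ((hol W z (plaqWord μ ν) : (Matrix n n ℂ)ˣ) : Matrix n n ℂ)‖
        ≤ ‖curlAt W Z z μ ν‖ + 6 * (Real.exp α - 1) * bondL1At Z z μ ν := h0
    _ ≤ 2 * ((32 * l₁ ^ 2 * γ + 2 * Λ₂') * s ^ ρ)
          + 1536 * l₁ ^ 4 * γ ^ 2 * Real.exp (8 * l₁ ^ 2 * γ) * s ^ ρ := add_le_add hcurl (h2.trans h3)
    _ = (2 * (32 * l₁ ^ 2 * γ + 2 * Λ₂') + 1536 * l₁ ^ 4 * γ ^ 2 * Real.exp (8 * l₁ ^ 2 * γ)) * s ^ ρ := by ring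

end Rates

/-! ## §2 NE7's consumer-side END from the covariant root WITH THE MULTI-SCALE THIRD CONJUNCT -/

section ConsumerEnd

variable {n : Type*} [Fintype n] [DecidableEq n]

/-- **NE7's CONSUMER-SIDE END FROM THE MULTI-SCALE β-ROOT** (`d = 4`, `L ≥ 2`, `N ≥ 1`, `θ⁶ = L⁻¹`, `0 ≤ b`, `512·5·8·L²·b ≤ 1`, `0 ≤ g`, `0 ≤ C`,
`Λ₂′ ≥ 0`, `0 ≤ β ≤ 1`): `h` = the covariant root `NE3EnergyRateWCov 4 𝒞 L N b g C Λ₁ Λ₂' dom` UNFOLDED with its third conjunct (Lip₂′ᶜ) REPLACED by the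
MULTI-SCALE Hölder member (Lip₂ᴹˢ)_β «along every lattice line of `W := rescale L (bavg L U_B)`, the covariant difference `j` steps ahead, transported back
by the line holonomy, differs from the one at the base by at most `Λ₂′·ξ^{2+β}·j^β`, `1 ≤ j ≤ L^k`» (everything else token for token); budget `γ > 0` with
`C·ρ₄ ≤ γ³`, cube root `l₁ > 0` with `Λ₁ ≤ l₁³`.  THEN at every level `k ≥ 1` with the FIT `γ(θ^k)² ≤ l₁N`, for every datum and minimiser pair: `∃ u Z`
with the representation and (P) `θ^{8k}`, (Gᶜ)∕(C)∕(Q) at `(θ^k)^{(12+14β)∕(1+β)}` — by module 1 §3 GEOMETRICALLY below the plaquette margin `ξ²` for EVERY `β > 0`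
(`N16HolderWindow.closeness_of_covRoot_holder`'s twin, whose rate `(θ^k)^{10+3β}` needs `β > 2∕3`).  The multi-scale β-root is a HYPOTHESIS — nobody's
theorem. [cite: Balaban1985BackgroundPropagators, (3.40) p.397; Balaban1985RegularSpaces, (1.36) p.82] [folklore] -/
theorem closeness_of_covRoot_holderMS [Nonempty n] {𝒞 : ℕ → Set (Site 4 → Fin 4 → (Matrix n n ℂ)ˣ)} {L N : ℕ} (hL : 2 ≤ L)
    (hN : 1 ≤ N) {θ : ℝ} (hθ : 0 < θ) (hθ6 : θ ^ 6 = ((L : ℝ))⁻¹) {b g C Λ₁ Λ₂' β : ℝ} (hb : 0 ≤ b)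
    (hbs : 512 * (4 + 1) * (4 + 4) * (L : ℝ) ^ 2 * b ≤ 1) (hg : 0 ≤ g) (hC : 0 ≤ C) (hΛ₂' : 0 ≤ Λ₂') (hβ0 : 0 ≤ β) (hβ1 : β ≤ 1)
    {dom : Set (Site 4 → Fin 4 → (Matrix n n ℂ)ˣ)}
    (h : ∀ k : ℕ, 1 ≤ k → ∀ V ∈ dom, ∀ UA UB : Site 4 → Fin 4 → (Matrix n n ℂ)ˣ,
      IsMinimiser 4 𝒞 L N k V UA → IsMinimiser 4 𝒞 L N (k + 1) V UB → Regular 4 L N b g (k + 1) UB →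
        ∃ (u : Site 4 → (Matrix n n ℂ)ˣ) (Z : Site 4 → Fin 4 → Matrix n n ℂ),
          IsUnitarySite u ∧ IsPeriodicSite u ((N * L ^ k : ℕ) : ℤ) ∧
          IsSkewDir Z ∧ IsPeriodicDir Z ((N * L ^ k : ℕ) : ℤ) ∧
          gaugeAct u UA = vary (rescale L (bavg L UB)) Z 1 ∧
          energyNormW L k (rescale L (bavg L UB)) Z (periodBox (N * L ^ k)) ≤ C * residualScale 4 L N b g k ∧
          (∀ (κ : Fin 4) (x : Site 4) (μ : Fin 4),
            ‖Ad (rescale L (bavg L UB) (x + e κ) μ) (Z (x + e μ) κ) - Z x κ‖ ≤ Λ₁ * (((L : ℝ)⁻¹) ^ k) ^ 2) ∧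
          (∀ (κ μ : Fin 4) (y : Site 4) (j : ℕ), 1 ≤ j → j ≤ L ^ k →
            ‖Ad (((List.range j).map fun i : ℕ => rescale L (bavg L UB) (y + e κ + i • e μ) μ).prod)
                  (Ad (rescale L (bavg L UB) (y + e κ + j • e μ) μ) (Z (y + (j + 1) • e μ) κ) - Z (y + j • e μ) κ)
              - (Ad (rescale L (bavg L UB) (y + e κ) μ) (Z (y + e μ) κ) - Z y κ)‖
              ≤ Λ₂' * (((L : ℝ)⁻¹) ^ k) ^ ((2 : ℝ) + β) * (j : ℝ) ^ β))
    {γ l₁ : ℝ} (hγ : 0 < γ)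
    (hγ3 : C * (wallConst 4 L * (N : ℝ) ^ 2 * (Real.sqrt g * dualC2 4 L + 2 * b ^ 2 * dualC1 4 L)) ≤ γ ^ 3)
    (hl₁ : 0 < l₁) (hΛl₁ : Λ₁ ≤ l₁ ^ 3)
    {k : ℕ} (hk : 1 ≤ k) (hfit : γ * (θ ^ k) ^ 2 ≤ l₁ * N)
    {V : Site 4 → Fin 4 → (Matrix n n ℂ)ˣ} (hV : V ∈ dom) {UA UB : Site 4 → Fin 4 → (Matrix n n ℂ)ˣ}
    (hA : IsMinimiser 4 𝒞 L N k V UA) (hB : IsMinimiser 4 𝒞 L N (k + 1) V UB) (hreg : Regular 4 L N b g (k + 1) UB) :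
    ∃ (u : Site 4 → (Matrix n n ℂ)ˣ) (Z : Site 4 → Fin 4 → Matrix n n ℂ),
      IsUnitarySite u ∧ IsPeriodicSite u ((N * L ^ k : ℕ) : ℤ) ∧ IsSkewDir Z ∧ IsPeriodicDir Z ((N * L ^ k : ℕ) : ℤ) ∧
      gaugeAct u UA = vary (rescale L (bavg L UB)) Z 1 ∧
      (∀ (x : Site 4) (κ : Fin 4), ‖Z x κ‖ ≤ 8 * l₁ ^ 2 * γ * θ ^ (8 * k)) ∧
      (∀ (x : Site 4) (μ κ : Fin 4),
        ‖Ad (rescale L (bavg L UB) (x + e κ) μ) (Z (x + e μ) κ) - Z x κ‖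
          ≤ (32 * l₁ ^ 2 * γ + 2 * Λ₂') * (θ ^ k) ^ (((12 : ℝ) + 14 * β) / (1 + β))) ∧
      (∀ (π : T4AveragingDeficitWall.Plane 4) (x : Site 4),
        ‖curl (rescale L (bavg L UB)) Z (x, π)‖
          ≤ 2 * ((32 * l₁ ^ 2 * γ + 2 * Λ₂') * (θ ^ k) ^ (((12 : ℝ) + 14 * β) / (1 + β)))) ∧
      (∀ (z : Site 4) (μ ν : Fin 4),
        ‖((hol (gaugeAct u UA) z (plaqWord μ ν) : (Matrix n n ℂ)ˣ) : Matrix n n ℂ)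
            - ((hol (rescale L (bavg L UB)) z (plaqWord μ ν) : (Matrix n n ℂ)ˣ) : Matrix n n ℂ)‖
          ≤ (2 * (32 * l₁ ^ 2 * γ + 2 * Λ₂') + 1536 * l₁ ^ 4 * γ ^ 2 * Real.exp (8 * l₁ ^ 2 * γ))
              * (θ ^ k) ^ (((12 : ℝ) + 14 * β) / (1 + β))) := by
  obtain ⟨u, Z, hu, huP, hZ, hZP, hrep, hE, h1, h2⟩ := h k hk V hV UA UB hA hB hreg
  have hL1 : 1 ≤ L := by omega
  obtain ⟨hWu, hWP⟩ := unitary_periodic_rescale_bavg_of_regular hL1 hb hbs hreg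
  have hEγ : (L : ℝ) ^ k * energyNormW L k (rescale L (bavg L UB)) Z (periodBox (d := 4) (N * L ^ k)) ≤ γ ^ 3 :=
    (energy_budget_of_residualScale hL1 N b hg hC k hE).trans hγ3
  refine ⟨u, Z, hu, huP, hZ, hZP, hrep, ?_, ?_, ?_, ?_⟩
  · exact fun x κ => norm_dir_le_rate_cov hL hN hk hθ hθ6 hWu hWP hZP hγ hl₁ hΛl₁ hEγ h1 hfit x κ
  · exact fun x μ κ =>
      norm_covDiff_le_rate_holderMS hL hN hk hθ hθ6 hWu hWP hZP hγ hl₁ hΛl₁ hΛ₂' hβ0 hβ1 hEγ h1 h2 hfit x μ κ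
  · exact fun π x => norm_curl_le_rate_holderMS hL hN hk hθ hθ6 hWu hWP hZP hγ hl₁ hΛl₁ hΛ₂' hβ0 hβ1 hEγ h1 h2 hfit π x
  · intro z μ ν
    rw [hrep]
    exact norm_hol_sub_le_rate_holderMS hL hN hk hθ hθ6 hWu hZ hWP hZP hγ hl₁ hΛl₁ hΛ₂' hβ0 hβ1 hEγ h1 h2 hfit z μ ν

end ConsumerEnd


end

end Summit.QuantumFields.YangMills.BalabanUVNodes.N16HolderMultiScaleRates
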